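import Literature.AlgebraicGeometry.HodgeTheory.VHSDataHodgeLocusInteriorChart
import Literature.Topology.LocallyFullOrIsolatedSubset
import HarnessLib

/-!
# The Hodge locus of bounded norm of a polarized `ℤ`-variation over a connected base of ANY dimension is the whole base or NOWHERE DENSE:
# «locally on `S`, `S^{(K)}` is a finite disjoint sum of closed analytic subspaces» (Cattani–Deligne–Kaplan §1) in local holomorphic
# period charts with values in `ℂ^d`

Topic `Literature/AlgebraicGeometry/HodgeTheory` (namespace `Literature.AlgebraicGeometry.Motives.VHSData`; model lemmas in
`Literature.AlgebraicGeometry.Motives`), the several-variable companion of `HodgeTheory/VHSDataHodgeLocusInteriorChart.lean` (one-dimensional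
base: everything or no accumulation point) over `Topology/LocallyFullOrIsolatedSubset.lean` §5 (near every point a neighbourhood inside `Z` or
empty interior ⟹ `Z` is everything or has empty interior).  THEOREMS ONLY (no definition, no named fact, no instance; D-0026 net debt `0`).

PRINTED SOURCE, VERBATIM (E. Cattani, P. Deligne, A. Kaplan, *On the locus of Hodge classes*, J. Amer. Math. Soc. 8 (1995), §1).  p. 483:
«It is also well known that, locally on `S`, the locus where a determination of `h_s` on the universal covering of `S` remains of type
`(p, p)` is analytic. More precisely, `S` can be covered by open subsets `U` with the following property: … at `h ∈ H_ℤ` of type `(p, p)`, the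
locus `T ⊂ U` where `h` remains of type `(p, p)`, i.e., in `ℱ^p`, is a complex analytic subspace of `U`.»  p. 484: «Fix an integer `K` and let
`S^{(K)}` be the space of pairs `(s, u)` with `s ∈ S`, `u ∈ 𝒱_s` integral of type `(0, 0)`, and `Q(u, u) ≤ K`. It projects to `S` and arguments as
above show that, locally on `S`, `S^{(K)}` is a finite disjoint sum of closed analytic subspaces.»

THE CHART (as in `VHSDataHodgeLocusInteriorChart`, the coordinate space now any complex normed space `E`, e.g. `ℂ^d`): `ρ : E → S`, `U ⊆ E`
open preconnected; for `c ∈ U`, `e c : V_{ρ(c)} ≃ V` (flat trivialization) carrying `Q` to `Q₀ = P₀.form` of a reference polarized Hodge structure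
`(H₀, P₀)` of weight `k = p + p` on the finite-dimensional `V`, `V_ℤ` ONTO the finitely generated `Λ`, and `F^p_{ρ(c)}` to `h(c)⁻¹F₀^p` with
the matrix coefficients `c ↦ φ(h(c)w)` holomorphic on `U`; a uniform comparison `κ‖1 ⊗ e_c x‖₀ ≤ ‖1 ⊗ x‖_{ρ(c)}` (`κ > 0`).
* §1 (model, any dimension) `forall_mem_or_interior_eq_empty_of_analyticOnNhd` — `{c ∈ U : h(c)v ∈ F}` is `U` or has EMPTY INTERIOR
  (identity principle on the preconnected `U`); `eventually_not_mem_of_not_mem` — its complement in `U` is open;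
  `exists_forall_mem_or_interior_eq_empty_of_finite` — finitely many `v` at once: some locus is `U`, or the union has empty interior.
* §2 `finite_flatValues_isHodgeAt_param_chart` / `exists_finite_hodgeLocusOfNormLe_param_chart_iff` — the parameter-free forms of the finiteness and
  of «`ρ(c) ∈ hodgeLocusOfNormLe D p K ⟺ ∃ v ∈ Υ, h(c)(1 ⊗ v) ∈ F₀^p`» (`Υ` finite) for a chart modelled on any type.
* §3 **`forall_mem_hodgeLocusOfNormLe_or_interior_eq_empty_chart`** — over a preconnected chart `U ⊆ E`: EITHER every `ρ(c)` lies in the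
  Hodge locus of norm `≤ K`, OR `{c ∈ U : ρ(c) ∈ locus}` has EMPTY INTERIOR; `eventually_not_mem_hodgeLocusOfNormLe_chart` — the locus is
  relatively closed over the chart.
* §4 through `ψ : OpenPartialHomeomorph S E`: `exists_mem_nhds_subset_or_interior_eq_empty_of_chart` (the hypothesis of
  `Literature.Topology.eq_univ_or_interior_eq_empty`), `compl_mem_nhds_of_not_mem_of_chart` (closedness).
* §5 **`hodgeLocusOfNormLe_eq_univ_or_isNowhereDense`** — **for `D : VHSData S k` on a preconnected `S` of any dimension covered by such
  charts, `hodgeLocusOfNormLe D p K` is CLOSED and is either ALL of `S` or NOWHERE DENSE** (a proper closed analytic subset of a connected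
  base has empty interior).

NOT HERE: algebraicity (Thm. 1.1 proper, several variables: Thm. 1.5 with `r ≥ 2` and GAGA), the dimension theory of the analytic subsets.

## References

* [CattaniDeligneKaplan1995] E. Cattani, P. Deligne, A. Kaplan, *On the locus of Hodge classes*, J. Amer. Math. Soc. 8 (1995) 483–506: §1
  (pp. 483–484).
* [VoisinHodgeII2003] C. Voisin, *Hodge Theory and Complex Algebraic Geometry II* (2003), §5.3.1, Lemma 5.13 (the Hodge locus of a flat class
  is a local analytic subset).
* [FritzscheGrauert2002] K. Fritzsche, H. Grauert, *From Holomorphic Functions to Complex Manifolds*, GTM 213 (2002), Ch. I §8 (analytic sets;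
  a proper analytic subset of a domain is nowhere dense).
* [Schmid1973] W. Schmid, *Variation of Hodge structure: the singularities of the period mapping*, Invent. Math. 22 (1973), §2–§3 (cite only).
-/

noncomputable section

open scoped TensorProduct ComplexOrder
open _root_.Topology _root_.Filter Set

namespace Literature.AlgebraicGeometry

open Module
open Motives Motives.HodgeStructure
open Motives.HodgeStructure (conj ofRat ofRat_apply conj_ofRat)

universe u

namespace Motives

variable {V : Type u} [AddCommGroup V] [Module ℚ V]
variable {E : Type*} [NormedAddCommGroup E] [NormedSpace ℂ E]

/-! ## §1 Model, any dimension: the locus `{h(c)v ∈ F}` is everything or has empty interior -/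

/-- **On a preconnected `U ⊆ E`, the locus `{c ∈ U : h(c)v ∈ F}` of a weakly holomorphic family of endomorphisms `h` is ALL of `U` or has
EMPTY INTERIOR** («the locus `T ⊂ U` where `h` remains … in `ℱ^p`, is a complex analytic subspace of `U`»; a holomorphic function vanishing on
a nonempty open subset of the preconnected `U` vanishes on `U`). [cite: CattaniDeligneKaplan1995, §1 (p. 483)] [cite: VoisinHodgeII2003, §5.3.1 Lemma 5.13]
[cite: FritzscheGrauert2002, Ch. I §8] -/
theorem forall_mem_or_interior_eq_empty_of_analyticOnNhd {U : Set E} (hU : IsPreconnected U)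
    (h : E → Module.End ℂ (ℂ ⊗[ℚ] V)) (hh : ∀ (φ : Module.Dual ℂ (ℂ ⊗[ℚ] V)) (w : ℂ ⊗[ℚ] V), AnalyticOnNhd ℂ (fun c => φ (h c w)) U)
    (F : Submodule ℂ (ℂ ⊗[ℚ] V)) (v : ℂ ⊗[ℚ] V) :
    (∀ c ∈ U, h c v ∈ F) ∨ interior {c : E | c ∈ U ∧ h c v ∈ F} = ∅ := by
  have hiff : ∀ c : E, h c v ∈ F ↔ ∀ φ : Module.Dual ℂ (ℂ ⊗[ℚ] V), φ ∈ F.dualAnnihilator → φ (h c v) = 0 :=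
    fun c => (Subspace.forall_mem_dualAnnihilator_apply_eq_zero_iff F (h c v)).symm
  by_cases hall : ∀ φ : Module.Dual ℂ (ℂ ⊗[ℚ] V), φ ∈ F.dualAnnihilator → ∀ c ∈ U, φ (h c v) = 0
  · exact Or.inl fun c hc => (hiff c).2 fun φ hφ => hall φ hφ c hc
  · right
    simp only [not_forall] at hall
    obtain ⟨φ, hφ, c₁, hc₁, hne⟩ := hall
    refine eq_empty_of_forall_notMem fun c₀ hc₀ => hne ?_
    -- `φ(h(c)v)` vanishes near the interior point `c₀ ∈ U`, hence on `U`
    have hev : ∀ᶠ c in 𝓝 c₀, c ∈ U ∧ h c v ∈ F := mem_interior_iff_mem_nhds.1 hc₀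
    have hc₀U : c₀ ∈ U := (hev.self_of_nhds).1
    have hzero : ∀ᶠ c in 𝓝 c₀, φ (h c v) = 0 := hev.mono fun c hc => (hiff c).1 hc.2 φ hφ
    exact (hh φ v).eqOn_zero_of_preconnected_of_eventuallyEq_zero hU hc₀U hzero hc₁

/-- **The complement of the locus is open in `U`**: if `h(c₁)v ∉ F` at a point `c₁ ∈ U` then `h(c)v ∉ F` near `c₁` (some `φ ∈ F^⊥` has
`φ(h(c)v) ≠ 0`, an open condition by continuity). [cite: CattaniDeligneKaplan1995, §1 (p. 483)] [cite: VoisinHodgeII2003, §5.3.1 Lemma 5.13] -/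
theorem eventually_not_mem_of_not_mem {U : Set E} (h : E → Module.End ℂ (ℂ ⊗[ℚ] V))
    (hh : ∀ (φ : Module.Dual ℂ (ℂ ⊗[ℚ] V)) (w : ℂ ⊗[ℚ] V), AnalyticOnNhd ℂ (fun c => φ (h c w)) U) (F : Submodule ℂ (ℂ ⊗[ℚ] V))
    (v : ℂ ⊗[ℚ] V) {c₁ : E} (hc₁ : c₁ ∈ U) (hv : h c₁ v ∉ F) : ∀ᶠ c in 𝓝 c₁, h c v ∉ F := by
  rw [← Subspace.forall_mem_dualAnnihilator_apply_eq_zero_iff F (h c₁ v)] at hv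
  simp only [not_forall] at hv
  obtain ⟨φ, hφ, hne⟩ := hv
  filter_upwards [((hh φ v) c₁ hc₁).continuousAt.eventually_ne hne] with c hc hmem
  exact hc ((Subspace.forall_mem_dualAnnihilator_apply_eq_zero_iff F (h c v)).2 hmem φ hφ)

/-- **Finitely many vectors at once (any dimension)**: on a preconnected `U`, either some `v ∈ Υ` (`Υ` finite) has `h(c)v ∈ F` for all
`c ∈ U`, or the union `{c ∈ U : ∃ v ∈ Υ, h(c)v ∈ F}` has EMPTY INTERIOR (a finite union of proper closed analytic subsets of a domain is
nowhere dense: peel off one relatively closed locus at a time). [cite: CattaniDeligneKaplan1995, §1 (p. 484)] [cite: FritzscheGrauert2002, Ch. I §8] -/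
theorem exists_forall_mem_or_interior_eq_empty_of_finite {U : Set E} (hU : IsPreconnected U)
    (h : E → Module.End ℂ (ℂ ⊗[ℚ] V)) (hh : ∀ (φ : Module.Dual ℂ (ℂ ⊗[ℚ] V)) (w : ℂ ⊗[ℚ] V), AnalyticOnNhd ℂ (fun c => φ (h c w)) U)
    (F : Submodule ℂ (ℂ ⊗[ℚ] V)) {Υ : Set (ℂ ⊗[ℚ] V)} (hΥ : Υ.Finite) :
    (∃ v ∈ Υ, ∀ c ∈ U, h c v ∈ F) ∨ interior {c : E | c ∈ U ∧ ∃ v ∈ Υ, h c v ∈ F} = ∅ := by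
  -- peeling: a nonempty open set inside a finite union of the loci contains a nonempty open set inside ONE locus
  have peel : ∀ {T : Set (ℂ ⊗[ℚ] V)}, T.Finite → ∀ O : Set E, IsOpen O → O.Nonempty → O ⊆ {c : E | c ∈ U ∧ ∃ v ∈ T, h c v ∈ F} →
      ∃ v ∈ T, ∃ O' : Set E, IsOpen O' ∧ O'.Nonempty ∧ O' ⊆ U ∧ ∀ c ∈ O', h c v ∈ F := by
    intro T hT
    induction T, hT using Set.Finite.induction_on with
    | empty =>
      intro O _ hOne hO
      obtain ⟨c, hc⟩ := hOne
      obtain ⟨-, v, hv, -⟩ := hO hc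
      exact absurd hv (notMem_empty v)
    | @insert a T _ _ ih =>
      intro O hO hOne hOsub
      by_cases ha : ∀ c ∈ O, h c a ∈ F
      · exact ⟨a, mem_insert a T, O, hO, hOne, fun c hc => (hOsub hc).1, ha⟩
      · simp only [not_forall] at ha
        obtain ⟨c₁, hc₁O, hc₁a⟩ := ha
        have hc₁U : c₁ ∈ U := (hOsub hc₁O).1
        -- an open neighbourhood of `c₁` avoiding the locus of `a`
        obtain ⟨W, hWsub, hWo, hc₁W⟩ := _root_.mem_nhds_iff.1 (eventually_not_mem_of_not_mem h hh F a hc₁U hc₁a)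
        obtain ⟨v, hv, O', hO', hO'ne, hO'U, hO'v⟩ := ih (O ∩ W) (hO.inter hWo) ⟨c₁, hc₁O, hc₁W⟩ fun c hc => by
          obtain ⟨hcU, w, hw, hwF⟩ := hOsub hc.1
          rcases (mem_insert_iff.1 hw) with rfl | hwT
          · exact absurd hwF (hWsub hc.2)
          · exact ⟨hcU, w, hwT, hwF⟩
        exact ⟨v, mem_insert_of_mem a hv, O', hO', hO'ne, hO'U, hO'v⟩
  by_cases hint : interior {c : E | c ∈ U ∧ ∃ v ∈ Υ, h c v ∈ F} = ∅
  · exact Or.inr hint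
  · left
    obtain ⟨v, hv, O', hO', ⟨c', hc'⟩, hO'U, hO'v⟩ := peel hΥ _ isOpen_interior (nonempty_iff_ne_empty.2 hint) interior_subset
    refine ⟨v, hv, (forall_mem_or_interior_eq_empty_of_analyticOnNhd hU h hh F v).resolve_right fun hempty => ?_⟩
    -- `O'` is a nonempty open subset of the locus of `v`
    have hsub : O' ⊆ interior {c : E | c ∈ U ∧ h c v ∈ F} := interior_maximal (fun c hc => ⟨hO'U hc, hO'v c hc⟩) hO'
    rw [hempty] at hsub
    exact hsub hc'

end Motives

namespace Motives.VHSData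

variable {S : Type} [TopologicalSpace S] {k : ℤ} (D : VHSData S k)
variable {V : Type u} [AddCommGroup V] [Module ℚ V] [FiniteDimensional ℚ V]

/-! ## §2 The finiteness and the locus over a chart modelled on any type -/

/-- **Finiteness of the flat values of the bounded integral Hodge classes over a chart** (any parameter type `X`): with `e c : V_{ρ(c)} ≃ V`
(`c ∈ U`) carrying `V_ℤ` into the finitely generated `Λ` and `κ‖1 ⊗ e_c x‖₀ ≤ ‖1 ⊗ x‖_{ρ(c)}`, the flat values `e_c(u)` of the integral Hodge
classes `u` at `ρ(c)` with `Q(u, u) ≤ K` form a finite set. [cite: CattaniDeligneKaplan1995, §1 (p. 484)] [cite: Schmid1973, §2 (cite only)] -/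
theorem finite_flatValues_isHodgeAt_param_chart {X : Type*} {p : ℤ} (hpk : p + p = k) (ρ : X → S) (U : Set X)
    (e : ∀ c : X, D.V.fiber (ρ c) ≃ₗ[ℚ] V) (H₀ : HodgeStructure V k) (P₀ : H₀.Polarization)
    (Λ : Submodule ℤ V) (hΛ : Λ.FG) (hΛ₁ : ∀ c ∈ U, ∀ u : D.VZ.fiber (ρ c), e c (D.toRat (ρ c) u) ∈ Λ)
    {κ : ℝ} (hκ : 0 < κ) (hnorm : ∀ c ∈ U, ∀ x : D.V.fiber (ρ c), κ * P₀.hodgeNorm (ofRat (e c x)) ≤ (D.form (ρ c)).hodgeNorm (ofRat x))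
    (K : ℤ) :
    {v : V | ∃ c ∈ U, ∃ u : D.VZ.fiber (ρ c), e c (D.toRat (ρ c) u) = v ∧ D.IsHodgeAt (ρ c) p u ∧
      (D.form (ρ c)).form (D.toRat (ρ c) u) (D.toRat (ρ c) u) ≤ (K : ℚ)}.Finite := by
  refine (P₀.finite_setOf_mem_hodgeNorm_ofRat_le_of_fg Λ hΛ (Real.sqrt K / κ)).subset ?_
  rintro v ⟨c, hc, u, rfl, hH, hK⟩
  refine ⟨hΛ₁ c hc u, ?_⟩
  have h1 : (D.form (ρ c)).hodgeNorm (ofRat (D.toRat (ρ c) u)) ≤ Real.sqrt K :=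
    (D.form (ρ c)).hodgeNorm_ofRat_le_sqrt_of_mem_hodgeClasses hpk hH (by exact_mod_cast hK)
  rw [le_div_iff₀ hκ, mul_comm]
  exact (hnorm c hc _).trans h1

/-- **The Hodge locus over a chart is cut out by finitely many flat classes** (any parameter type): there is a finite `Υ ⊆ Λ ∖ 0` with
`ρ(c) ∈ hodgeLocusOfNormLe D p K ⟺ ∃ v ∈ Υ, h(c)(1 ⊗ v) ∈ F₀^p` for `c ∈ U`. [cite: CattaniDeligneKaplan1995, §1 (pp. 483–484)]
[cite: Schmid1973, §2 (cite only)] -/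
theorem exists_finite_hodgeLocusOfNormLe_param_chart_iff {X : Type*} {p : ℤ} (hpk : p + p = k) (ρ : X → S) (U : Set X)
    (e : ∀ c : X, D.V.fiber (ρ c) ≃ₗ[ℚ] V) (H₀ : HodgeStructure V k) (P₀ : H₀.Polarization) (h : X → Module.End ℂ (ℂ ⊗[ℚ] V))
    (hF : ∀ c ∈ U, ((D.hodge (ρ c)).F p).map ((e c).toLinearMap.baseChange ℂ) = (H₀.F p).comap (h c))
    (hQ : ∀ c ∈ U, ∀ x y : D.V.fiber (ρ c), (D.form (ρ c)).form x y = P₀.form (e c x) (e c y))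
    (Λ : Submodule ℤ V) (hΛ : Λ.FG) (hΛ₁ : ∀ c ∈ U, ∀ u : D.VZ.fiber (ρ c), e c (D.toRat (ρ c) u) ∈ Λ)
    (hΛ₂ : ∀ c ∈ U, ∀ v ∈ Λ, ∃ u : D.VZ.fiber (ρ c), e c (D.toRat (ρ c) u) = v)
    {κ : ℝ} (hκ : 0 < κ) (hnorm : ∀ c ∈ U, ∀ x : D.V.fiber (ρ c), κ * P₀.hodgeNorm (ofRat (e c x)) ≤ (D.form (ρ c)).hodgeNorm (ofRat x))
    (K : ℤ) :
    ∃ Υ : Set V, Υ.Finite ∧ (∀ v ∈ Υ, v ∈ Λ ∧ v ≠ 0 ∧ P₀.form v v ≤ (K : ℚ)) ∧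
      ∀ c ∈ U, ρ c ∈ D.hodgeLocusOfNormLe p K ↔ ∃ v ∈ Υ, h c (ofRat v) ∈ H₀.F p := by
  have key : ∀ c ∈ U, ∀ u : D.VZ.fiber (ρ c), (D.IsHodgeAt (ρ c) p u ↔ h c (ofRat (e c (D.toRat (ρ c) u))) ∈ H₀.F p) ∧
      ((D.form (ρ c)).form (D.toRat (ρ c) u) (D.toRat (ρ c) u) = P₀.form (e c (D.toRat (ρ c) u)) (e c (D.toRat (ρ c) u))) :=
    fun c hc u => ⟨by rw [D.isHodgeAt_iff_ofRat_mem_of_map_F_eq (e c) (hF c hc) u, Submodule.mem_comap], hQ c hc _ _⟩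
  set Υ : Set V := {v : V | ∃ c ∈ U, ∃ u : D.VZ.fiber (ρ c), e c (D.toRat (ρ c) u) = v ∧ D.IsHodgeAt (ρ c) p u ∧
      (D.form (ρ c)).form (D.toRat (ρ c) u) (D.toRat (ρ c) u) ≤ (K : ℚ)} ∩ {v | v ≠ 0} with hΥ_def
  refine ⟨Υ, (D.finite_flatValues_isHodgeAt_param_chart hpk ρ U e H₀ P₀ Λ hΛ hΛ₁ hκ hnorm K).inter_of_left _, ?_, fun c hc => ?_⟩
  · rintro v ⟨⟨c, hc, u, rfl, hH, hK⟩, hv0⟩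
    exact ⟨hΛ₁ c hc u, hv0, by rw [← (key c hc u).2]; exact hK⟩
  constructor
  · rintro ⟨u, hu0, hH, hK⟩
    refine ⟨e c (D.toRat (ρ c) u), ⟨⟨c, hc, u, rfl, hH, hK⟩, fun h0 => hu0 (D.eq_zero_of_equiv_toRat_eq_zero (e c) h0)⟩,
      ((key c hc u).1).1 hH⟩
  · rintro ⟨v, ⟨⟨c', hc', u', rfl, hH', hK'⟩, hv0⟩, hmem⟩
    obtain ⟨u, hu⟩ := hΛ₂ c hc _ (hΛ₁ c' hc' u')
    refine ⟨u, fun h0 => hv0 ?_, ?_, ?_⟩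
    · rw [← hu, h0, map_zero, map_zero]
    · rw [(key c hc u).1, hu]
      exact hmem
    · rw [(key c hc u).2, hu, ← (key c' hc' u').2]
      exact hK'

/-! ## §3 Over a preconnected open chart in `E`: everything or empty interior; relative closedness -/

variable {E : Type*} [NormedAddCommGroup E] [NormedSpace ℂ E]

/-- **CDK §1 over a base of any dimension, interior point: over a preconnected open chart `U ⊆ E`, EITHER every `ρ(c)` lies in the Hodge locus of
norm `≤ K`, OR `{c ∈ U : ρ(c) ∈ locus}` has EMPTY INTERIOR** («locally on `S`, `S^{(K)}` is a finite disjoint sum of closed analytic subspaces»: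
finitely many flat classes, each with locus `U` or of empty interior). [cite: CattaniDeligneKaplan1995, §1 (pp. 483–484)]
[cite: VoisinHodgeII2003, §5.3.1 Lemma 5.13] [cite: FritzscheGrauert2002, Ch. I §8] -/
theorem forall_mem_hodgeLocusOfNormLe_or_interior_eq_empty_chart {p : ℤ} (hpk : p + p = k) (ρ : E → S) {U : Set E}
    (hUc : IsPreconnected U) (e : ∀ c : E, D.V.fiber (ρ c) ≃ₗ[ℚ] V) (H₀ : HodgeStructure V k) (P₀ : H₀.Polarization)
    (h : E → Module.End ℂ (ℂ ⊗[ℚ] V)) (hh : ∀ (φ : Module.Dual ℂ (ℂ ⊗[ℚ] V)) (w : ℂ ⊗[ℚ] V), AnalyticOnNhd ℂ (fun c => φ (h c w)) U)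
    (hF : ∀ c ∈ U, ((D.hodge (ρ c)).F p).map ((e c).toLinearMap.baseChange ℂ) = (H₀.F p).comap (h c))
    (hQ : ∀ c ∈ U, ∀ x y : D.V.fiber (ρ c), (D.form (ρ c)).form x y = P₀.form (e c x) (e c y))
    (Λ : Submodule ℤ V) (hΛ : Λ.FG) (hΛ₁ : ∀ c ∈ U, ∀ u : D.VZ.fiber (ρ c), e c (D.toRat (ρ c) u) ∈ Λ)
    (hΛ₂ : ∀ c ∈ U, ∀ v ∈ Λ, ∃ u : D.VZ.fiber (ρ c), e c (D.toRat (ρ c) u) = v)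
    {κ : ℝ} (hκ : 0 < κ) (hnorm : ∀ c ∈ U, ∀ x : D.V.fiber (ρ c), κ * P₀.hodgeNorm (ofRat (e c x)) ≤ (D.form (ρ c)).hodgeNorm (ofRat x))
    (K : ℤ) :
    (∀ c ∈ U, ρ c ∈ D.hodgeLocusOfNormLe p K) ∨ interior {c : E | c ∈ U ∧ ρ c ∈ D.hodgeLocusOfNormLe p K} = ∅ := by
  obtain ⟨Υ, hΥ, -, hiff⟩ := D.exists_finite_hodgeLocusOfNormLe_param_chart_iff hpk ρ U e H₀ P₀ h hF hQ Λ hΛ hΛ₁ hΛ₂ hκ hnorm K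
  rcases exists_forall_mem_or_interior_eq_empty_of_finite hUc h hh (H₀.F p) (hΥ.image ofRat) with ⟨w, ⟨v, hv, rfl⟩, hall⟩ | hint
  · exact Or.inl fun c hc => (hiff c hc).2 ⟨v, hv, hall c hc⟩
  · refine Or.inr ?_
    have hsub : {c : E | c ∈ U ∧ ρ c ∈ D.hodgeLocusOfNormLe p K} ⊆ {c : E | c ∈ U ∧ ∃ w ∈ ofRat '' Υ, h c w ∈ H₀.F p} := by
      rintro c ⟨hcU, hc⟩
      obtain ⟨v, hv, hvF⟩ := (hiff c hcU).1 hc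
      exact ⟨hcU, ofRat v, ⟨v, hv, rfl⟩, hvF⟩
    exact subset_empty_iff.1 (hint ▸ interior_mono hsub)

/-- **The Hodge locus is relatively closed over the chart**: if `ρ(c₁)` is NOT in the Hodge locus of norm `≤ K` (`c₁ ∈ U`), then neither is
`ρ(c)` for `c` near `c₁` (finitely many open conditions `h(c)(1 ⊗ v) ∉ F₀^p`, `v ∈ Υ`). [cite: CattaniDeligneKaplan1995, §1 (p. 484)] -/
theorem eventually_not_mem_hodgeLocusOfNormLe_chart {p : ℤ} (hpk : p + p = k) (ρ : E → S) {U : Set E}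
    (e : ∀ c : E, D.V.fiber (ρ c) ≃ₗ[ℚ] V) (H₀ : HodgeStructure V k) (P₀ : H₀.Polarization)
    (h : E → Module.End ℂ (ℂ ⊗[ℚ] V)) (hh : ∀ (φ : Module.Dual ℂ (ℂ ⊗[ℚ] V)) (w : ℂ ⊗[ℚ] V), AnalyticOnNhd ℂ (fun c => φ (h c w)) U)
    (hF : ∀ c ∈ U, ((D.hodge (ρ c)).F p).map ((e c).toLinearMap.baseChange ℂ) = (H₀.F p).comap (h c))
    (hQ : ∀ c ∈ U, ∀ x y : D.V.fiber (ρ c), (D.form (ρ c)).form x y = P₀.form (e c x) (e c y))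
    (Λ : Submodule ℤ V) (hΛ : Λ.FG) (hΛ₁ : ∀ c ∈ U, ∀ u : D.VZ.fiber (ρ c), e c (D.toRat (ρ c) u) ∈ Λ)
    (hΛ₂ : ∀ c ∈ U, ∀ v ∈ Λ, ∃ u : D.VZ.fiber (ρ c), e c (D.toRat (ρ c) u) = v)
    {κ : ℝ} (hκ : 0 < κ) (hnorm : ∀ c ∈ U, ∀ x : D.V.fiber (ρ c), κ * P₀.hodgeNorm (ofRat (e c x)) ≤ (D.form (ρ c)).hodgeNorm (ofRat x))
    (K : ℤ) {c₁ : E} (hc₁ : c₁ ∈ U) (hnot : ρ c₁ ∉ D.hodgeLocusOfNormLe p K) :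
    ∀ᶠ c in 𝓝 c₁, c ∈ U → ρ c ∉ D.hodgeLocusOfNormLe p K := by
  obtain ⟨Υ, hΥ, -, hiff⟩ := D.exists_finite_hodgeLocusOfNormLe_param_chart_iff hpk ρ U e H₀ P₀ h hF hQ Λ hΛ hΛ₁ hΛ₂ hκ hnorm K
  have hv : ∀ v ∈ Υ, h c₁ (ofRat v) ∉ H₀.F p := fun v hv hmem => hnot ((hiff c₁ hc₁).2 ⟨v, hv, hmem⟩)
  have hev : ∀ᶠ c in 𝓝 c₁, ∀ v ∈ Υ, h c (ofRat v) ∉ H₀.F p :=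
    hΥ.eventually_all.2 fun v hv' => eventually_not_mem_of_not_mem h hh (H₀.F p) (ofRat v) hc₁ (hv v hv')
  filter_upwards [hev] with c hc hcU hmem
  obtain ⟨v, hv', hvF⟩ := (hiff c hcU).1 hmem
  exact hc v hv' hvF

/-! ## §4 Through a chart `ψ : OpenPartialHomeomorph S E` -/

/-- **At a point of a chart domain: a neighbourhood inside the Hodge locus, or the locus has empty interior on the domain** — the hypothesis of
`Literature.Topology.eq_univ_or_interior_eq_empty`.  Chart `ψ : OpenPartialHomeomorph S E` with preconnected target and the data
`(e, H₀, P₀, h, Λ, κ)` of `forall_mem_hodgeLocusOfNormLe_or_interior_eq_empty_chart` for `ρ = ψ.symm`, `U = ψ.target`.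
[cite: CattaniDeligneKaplan1995, §1 (pp. 483–484)] [cite: FritzscheGrauert2002, Ch. I §8] -/
theorem exists_mem_nhds_subset_or_interior_eq_empty_of_chart {p : ℤ} (hpk : p + p = k) (ψ : OpenPartialHomeomorph S E)
    (hconn : IsPreconnected ψ.target) (e : ∀ c : E, D.V.fiber (ψ.symm c) ≃ₗ[ℚ] V) (H₀ : HodgeStructure V k) (P₀ : H₀.Polarization)
    (h : E → Module.End ℂ (ℂ ⊗[ℚ] V)) (hh : ∀ (φ : Module.Dual ℂ (ℂ ⊗[ℚ] V)) (w : ℂ ⊗[ℚ] V), AnalyticOnNhd ℂ (fun c => φ (h c w)) ψ.target)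
    (hF : ∀ c ∈ ψ.target, ((D.hodge (ψ.symm c)).F p).map ((e c).toLinearMap.baseChange ℂ) = (H₀.F p).comap (h c))
    (hQ : ∀ c ∈ ψ.target, ∀ x y : D.V.fiber (ψ.symm c), (D.form (ψ.symm c)).form x y = P₀.form (e c x) (e c y))
    (Λ : Submodule ℤ V) (hΛ : Λ.FG) (hΛ₁ : ∀ c ∈ ψ.target, ∀ u : D.VZ.fiber (ψ.symm c), e c (D.toRat (ψ.symm c) u) ∈ Λ)
    (hΛ₂ : ∀ c ∈ ψ.target, ∀ v ∈ Λ, ∃ u : D.VZ.fiber (ψ.symm c), e c (D.toRat (ψ.symm c) u) = v)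
    {κ : ℝ} (hκ : 0 < κ)
    (hnorm : ∀ c ∈ ψ.target, ∀ x : D.V.fiber (ψ.symm c), κ * P₀.hodgeNorm (ofRat (e c x)) ≤ (D.form (ψ.symm c)).hodgeNorm (ofRat x))
    (K : ℤ) {x : S} (hx : x ∈ ψ.source) :
    ∃ W ∈ 𝓝 x, W ⊆ D.hodgeLocusOfNormLe p K ∨ interior (D.hodgeLocusOfNormLe p K ∩ W) = ∅ := by
  refine ⟨ψ.source, ψ.open_source.mem_nhds hx, ?_⟩
  rcases D.forall_mem_hodgeLocusOfNormLe_or_interior_eq_empty_chart hpk ψ.symm hconn e H₀ P₀ h hh hF hQ Λ hΛ hΛ₁ hΛ₂ hκ hnorm K with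
    hall | hint
  · refine Or.inl fun y hy => ?_
    have h1 := hall (ψ y) (ψ.map_source hy)
    rwa [ψ.left_inv hy] at h1
  · refine Or.inr (eq_empty_of_forall_notMem fun y hy => ?_)
    -- the image of the open set `interior (Z ∩ source)` is a nonempty open subset of `{c ∈ target : ψ.symm c ∈ Z}`
    set O : Set S := interior (D.hodgeLocusOfNormLe p K ∩ ψ.source) with hO
    have hOsrc : O ⊆ ψ.source := interior_subset.trans inter_subset_right
    have hOopen : IsOpen (ψ '' O) := (ψ.isOpen_image_iff_of_subset_source hOsrc).2 isOpen_interior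
    have hOsub : ψ '' O ⊆ {c : E | c ∈ ψ.target ∧ ψ.symm c ∈ D.hodgeLocusOfNormLe p K} := by
      rintro _ ⟨z, hz, rfl⟩
      refine ⟨ψ.map_source (hOsrc hz), ?_⟩
      rw [ψ.left_inv (hOsrc hz)]
      exact (interior_subset hz).1
    have hmem : ψ y ∈ interior {c : E | c ∈ ψ.target ∧ ψ.symm c ∈ D.hodgeLocusOfNormLe p K} :=
      interior_maximal hOsub hOopen ⟨y, hy, rfl⟩
    rw [hint] at hmem
    exact hmem

/-- **Outside the Hodge locus, a whole neighbourhood is outside** (the locus is closed on each chart domain): for `x` in a chart domain with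
`x ∉ hodgeLocusOfNormLe D p K`, the complement of the locus is a neighbourhood of `x`. [cite: CattaniDeligneKaplan1995, §1 (p. 484)] -/
theorem compl_hodgeLocusOfNormLe_mem_nhds_of_chart {p : ℤ} (hpk : p + p = k) (ψ : OpenPartialHomeomorph S E)
    (e : ∀ c : E, D.V.fiber (ψ.symm c) ≃ₗ[ℚ] V) (H₀ : HodgeStructure V k) (P₀ : H₀.Polarization)
    (h : E → Module.End ℂ (ℂ ⊗[ℚ] V)) (hh : ∀ (φ : Module.Dual ℂ (ℂ ⊗[ℚ] V)) (w : ℂ ⊗[ℚ] V), AnalyticOnNhd ℂ (fun c => φ (h c w)) ψ.target)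
    (hF : ∀ c ∈ ψ.target, ((D.hodge (ψ.symm c)).F p).map ((e c).toLinearMap.baseChange ℂ) = (H₀.F p).comap (h c))
    (hQ : ∀ c ∈ ψ.target, ∀ x y : D.V.fiber (ψ.symm c), (D.form (ψ.symm c)).form x y = P₀.form (e c x) (e c y))
    (Λ : Submodule ℤ V) (hΛ : Λ.FG) (hΛ₁ : ∀ c ∈ ψ.target, ∀ u : D.VZ.fiber (ψ.symm c), e c (D.toRat (ψ.symm c) u) ∈ Λ)
    (hΛ₂ : ∀ c ∈ ψ.target, ∀ v ∈ Λ, ∃ u : D.VZ.fiber (ψ.symm c), e c (D.toRat (ψ.symm c) u) = v)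
    {κ : ℝ} (hκ : 0 < κ)
    (hnorm : ∀ c ∈ ψ.target, ∀ x : D.V.fiber (ψ.symm c), κ * P₀.hodgeNorm (ofRat (e c x)) ≤ (D.form (ψ.symm c)).hodgeNorm (ofRat x))
    (K : ℤ) {x : S} (hx : x ∈ ψ.source) (hnot : x ∉ D.hodgeLocusOfNormLe p K) : (D.hodgeLocusOfNormLe p K)ᶜ ∈ 𝓝 x := by
  have hc₀ : ψ x ∈ ψ.target := ψ.map_source hx
  have hnot' : ψ.symm (ψ x) ∉ D.hodgeLocusOfNormLe p K := by rwa [ψ.left_inv hx]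
  have hev := D.eventually_not_mem_hodgeLocusOfNormLe_chart hpk ψ.symm e H₀ P₀ h hh hF hQ Λ hΛ hΛ₁ hΛ₂ hκ hnorm K hc₀ hnot'
  -- pull back along the continuous `ψ` at `x`
  have h1 : ∀ᶠ y in 𝓝 x, y ∈ ψ.source := ψ.open_source.mem_nhds hx
  have h2 := (ψ.continuousAt hx).eventually hev
  filter_upwards [h1, h2] with y hy hPy
  have h3 := hPy (ψ.map_source hy)
  rwa [ψ.left_inv hy] at h3

/-! ## §5 Everything or nowhere dense -/

/-- **THE HODGE LOCUS OF BOUNDED NORM OVER A CONNECTED BASE OF ANY DIMENSION IS EVERYTHING OR NOWHERE DENSE.**  `D : VHSData S k`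
(`k = p + p`) on a preconnected `S`; at every point `x` an interior period chart: `ψ : OpenPartialHomeomorph S E` (`E` a complex normed space,
e.g. `ℂ^d`) with `x ∈ ψ.source` and preconnected target, a flat trivialization `e c : V_{ψ⁻¹(c)} ≃ V` carrying `Q` to `Q₀`, `V_ℤ` ONTO a
finitely generated `Λ₀` and `F^p` to `h(c)⁻¹F₀^p` with `h` weakly holomorphic, and a comparison `κ‖1 ⊗ e_c x‖₀ ≤ ‖1 ⊗ x‖_{ψ⁻¹(c)}`.  Then
**`hodgeLocusOfNormLe D p K` is CLOSED, and it is either ALL of `S` or NOWHERE DENSE** («locally on `S`, `S^{(K)}` is a finite disjoint sum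
of closed analytic subspaces»; a proper closed analytic subset of a connected manifold has empty interior).
[cite: CattaniDeligneKaplan1995, §1 (pp. 483–484)] [cite: VoisinHodgeII2003, §5.3.1 Lemma 5.13] [cite: FritzscheGrauert2002, Ch. I §8] -/
theorem hodgeLocusOfNormLe_eq_univ_or_isNowhereDense [PreconnectedSpace S] {p : ℤ} (hpk : p + p = k) (K : ℤ)
    (hint : ∀ x : S, ∃ ψ : OpenPartialHomeomorph S E, x ∈ ψ.source ∧ IsPreconnected ψ.target ∧
      ∃ (e : ∀ c : E, D.V.fiber (ψ.symm c) ≃ₗ[ℚ] V) (H₀ : HodgeStructure V k) (P₀ : H₀.Polarization) (h : E → Module.End ℂ (ℂ ⊗[ℚ] V))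
        (Λ₀ : Submodule ℤ V) (κ : ℝ),
        (∀ (φ : Module.Dual ℂ (ℂ ⊗[ℚ] V)) (w : ℂ ⊗[ℚ] V), AnalyticOnNhd ℂ (fun c => φ (h c w)) ψ.target) ∧
        (∀ c ∈ ψ.target, ((D.hodge (ψ.symm c)).F p).map ((e c).toLinearMap.baseChange ℂ) = (H₀.F p).comap (h c)) ∧
        (∀ c ∈ ψ.target, ∀ x y : D.V.fiber (ψ.symm c), (D.form (ψ.symm c)).form x y = P₀.form (e c x) (e c y)) ∧
        Λ₀.FG ∧ (∀ c ∈ ψ.target, ∀ u : D.VZ.fiber (ψ.symm c), e c (D.toRat (ψ.symm c) u) ∈ Λ₀) ∧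
        (∀ c ∈ ψ.target, ∀ v ∈ Λ₀, ∃ u : D.VZ.fiber (ψ.symm c), e c (D.toRat (ψ.symm c) u) = v) ∧
        0 < κ ∧ (∀ c ∈ ψ.target, ∀ x : D.V.fiber (ψ.symm c), κ * P₀.hodgeNorm (ofRat (e c x)) ≤ (D.form (ψ.symm c)).hodgeNorm (ofRat x))) :
    IsClosed (D.hodgeLocusOfNormLe p K) ∧ (D.hodgeLocusOfNormLe p K = univ ∨ IsNowhereDense (D.hodgeLocusOfNormLe p K)) := by
  have hclosed : IsClosed (D.hodgeLocusOfNormLe p K) := by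
    rw [← isOpen_compl_iff, isOpen_iff_mem_nhds]
    intro x hx
    obtain ⟨ψ, hxψ, -, e, H₀, P₀, h, Λ₀, κ, hh, hF, hQ, hΛ₀, hΛ₁, hΛ₂, hκ, hnorm⟩ := hint x
    exact D.compl_hodgeLocusOfNormLe_mem_nhds_of_chart hpk ψ e H₀ P₀ h hh hF hQ Λ₀ hΛ₀ hΛ₁ hΛ₂ hκ hnorm K hxψ hx
  refine ⟨hclosed, Literature.Topology.eq_univ_or_isNowhereDense hclosed fun x => ?_⟩
  obtain ⟨ψ, hxψ, hconn, e, H₀, P₀, h, Λ₀, κ, hh, hF, hQ, hΛ₀, hΛ₁, hΛ₂, hκ, hnorm⟩ := hint x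
  exact D.exists_mem_nhds_subset_or_interior_eq_empty_of_chart hpk ψ hconn e H₀ P₀ h hh hF hQ Λ₀ hΛ₀ hΛ₁ hΛ₂ hκ hnorm K hxψ

end Motives.VHSData

end Literature.AlgebraicGeometry

end
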